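import Summits.QuantumFields.BalabanUV.Beta.GAN24.CombContactGaugeStaircaseCauchyPack

/-!
# `BalabanUV.Beta.GAN24.CombContactGaugeStaircaseCauchyHolds` — binder row G-an2-4 ∕ (CONV-C), TRANSFER-III, the (III′) S-slot (b) of the END R `CombChargeRowsClosed`, the (III′)
# WILSON CONTACT RATE END `hCTd′`, step CT-4b AT THE COMB CHART, part 3: **CT-4b PACKAGED AT ONE COMMON RATE FROM `2 ≤ Lc` ALONE** — the (III′) twin of road-P2 g34's
# `ContactGaugeStaircaseCauchyPack.exists_gauge_staircase_cauchy`: ONE rate `κ > 0` (the minimum of leaf-12's (N1) rate and road-P2's CT-4a rate), amplitudes `α₀` (the non-small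
# letters: (N1) `C` and the root-free face letter `F = Σ_{r′∈box} faceWtSum r′ Lc`) and `α_d` (the `θ^k`-small letters: CT-4a `c`), the CT-4a ratio `0 ≤ θ < 1`, such that for EVERY
# root pair `r, rr ∈ box 4 Lc`, every `k` and every source bond, on the taller tower's fine lattice (envelope block `Lc^(k+2)`; `(k+3)`-staircases):
# (i)∕(ii) tower `k+1`'s conjugated bond gauge function IS the clean-index staircase with geometric letters `α₀·(Lc^{5(k+2)})⁻¹·Lc^{s′}`; (iii)∕(iv) tower `k`'s, transported, IS the
# staircase `Gup′` with the SAME letters; (v)∕(vi) their difference IS the staircase `ΔG′` with letters `α₀·(Lc^{5(k+2)})⁻¹` at `s′ = 0`, `(α_d·θ^k·Lc + α₀)·(Lc^{5(k+2)})⁻¹` at `s′ = 1`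
# (the TWO extra finest pieces: NOT small by `θ^k`) and `α_d·θ^k·(Lc^{5(k+2)})⁻¹·Lc^{s′}` for `2 ≤ s′ ≤ k+2`.

NOT IN PRINT; OUR BOOKKEEPING (G-an2-4 formalisation swarm, leaf prover `b2b-balaban-gan24-formalise-leaf-01`, gen 89; [folklore] packaging BY NAME of MY `CombContactGaugeStaircaseCauchy(Pack)`
at leaf-12's (N1) data `RespStepDecay.exists_respStep_decay_and_grad` and road-P2's CT-4a data `RespStepCauchy.exists_respStep_cauchy`; 0 `def`, 0 cited facts, 0 `def … : Prop`, 0 sorry).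
HONEST FRAMING (cell contract, verbatim): «discharging `BetaPertH` makes Bałaban's UV stability UNCONDITIONAL — a real constructive-QFT result; it is NOT the continuum limit and NOT
the Clay problem.»  HONEST DEPENDENCY (verbatim): «continuum YM on T⁴ ⇐ BetaPertH ∧ nine spine estimates (0/9 proved); BetaPertH ⇐ (D1) ∧ (D4) ∧ CAP+tail; G-an2-4 gates asym, D1 and NE2/3/4.»
What is LEFT of `hCTd′` after this file: the (III′) twins of road-P2's∕leaf-02's two-tower ATOM chains (`ContactGaugeRefine`, `ContactRefineB*`, `ContactRefineP*`, `ContactCauchyCells ∕ Assembly`)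
fed with these six clauses (staircase length `k+2`, two non-small finest pieces).  NO new estimate; discharges NOTHING of (hS, hSall); NEVER «G-an2-4 closed» as (CONV-C); NOT D1, NOT
BetaPertH, NOT continuum, NOT Clay.  2026-08-28; no existing file touched.
-/

noncomputable section

open Finset
open scoped BigOperators
open Literature.MathematicalPhysics.QuantumFieldTheory
open Literature.MathematicalPhysics.QuantumFieldTheory.LatticeForm (quo)
open Literature.MathematicalPhysics.QuantumFieldTheory.Balaban1983to89
open Literature.MathematicalPhysics.QuantumFieldTheory.Balaban1983to89.Beta
open B4ContourShift (supNorm supNorm_nonneg)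
open AffineAveraging (Form0 Form1 Site box toSite)
open AveragingContours (blk)
open KKTFluctuationKernel (delta1)
open BalabanCompositeJets (respStep)
open Summit.QuantumFields.BalabanUV.Beta.AxialProjectorBlockMean (bmGaugeAt)
open Summit.QuantumFields.BalabanUV.Beta.SymCorrectorForms (zetaS)
open Summit.QuantumFields.BalabanUV.Beta.SymCorrectorFace (faceWtSum faceWtSum_nonneg)
open Summit.QuantumFields.BalabanUV.Beta.GAN24.Push4Iter (legChain)
open Summit.QuantumFields.BalabanUV.Beta.GAN24.RespStepBmDecompLegs (legAct)
open Summit.QuantumFields.BalabanUV.Beta.GAN24.RespStepBmDecompExact (respStepBmSeq)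
open Summit.QuantumFields.BalabanUV.Beta.GAN24.RespStepBmDecompPsi (Psi)
open Summit.QuantumFields.BalabanUV.Beta.GAN24.RespStepDecay (exists_respStep_decay_and_grad)
open Summit.QuantumFields.BalabanUV.Beta.GAN24.RespStepCauchy (exists_respStep_cauchy)
open Summit.QuantumFields.BalabanUV.Beta.GAN24.UndressedResponseUnits (inv_cast_pow_pow)
open Summit.QuantumFields.BalabanUV.Beta.GAN24.ContactGaugeStaircaseCauchy (exp_env_mono)
open Summit.QuantumFields.BalabanUV.Beta.GAN24.CombLegChainGauge (PsiFace)
open Summit.QuantumFields.BalabanUV.Beta.GAN24.CombContactGaugeStaircaseCauchy (combGauge_eq_staircase_zero combGauge_coarse_eq_staircase_fine combGauge_refine_eq_staircase)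
open Summit.QuantumFields.BalabanUV.Beta.GAN24.CombContactGaugeStaircaseCauchyPack (abs_combPieceZero_le abs_combPieceUp_le abs_combPieceDiff_le abs_combPieceDiff_one_le
  abs_combPieceDiff_zero_le)

namespace Summit.QuantumFields.BalabanUV.Beta.GAN24.CombContactGaugeStaircaseCauchyHolds

variable {Lc : ℕ} [NeZero Lc]

/-- NOT IN PRINT; OUR BOOKKEEPING.  **CT-4b AT THE COMB CHART, PACKAGED** (`d = 3`, every `Lc ≥ 2`, NO hypothesis; every root pair `r, rr ∈ box`): see the module docstring for the six clauses.
`κ = min κ₀ κ₁`, `α₀ = 8·Lc·C + F·(1+8Lc(e^{κ₀}+1))·C`, `α_d = (8·Lc + F·(1+8Lc(e^{κ₁}+1)))·c`, `F = Σ_{r′ ∈ box} faceWtSum r′ Lc`. -/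
theorem exists_combGauge_staircase_cauchy (hLc : 2 ≤ Lc) :
    ∃ κ α₀ αd θ : ℝ, 0 < κ ∧ 0 ≤ α₀ ∧ 0 ≤ αd ∧ 0 ≤ θ ∧ θ < 1 ∧
      ∀ (r : Fin (3 + 1) → ℕ), r ∈ box (3 + 1) Lc → ∀ (rr : Fin (3 + 1) → ℕ), rr ∈ box (3 + 1) Lc → ∀ (k : ℕ) (μ : Fin (3 + 1)) (z : Site (3 + 1)),
        (∀ u' : Site (3 + 1),
          Psi (toSite rr) Lc 0 (k + 1) (delta1 μ z) u' + PsiFace r (toSite rr) Lc 0 (k + 1) (delta1 μ z) u'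
              - bmGaugeAt (toSite rr) (respStep (d := 3) 1 (Lc ^ (k + 2)) μ z) Lc u'
            = ∑ s' ∈ Finset.range (k + 2 + 1),
                (fun (s' : ℕ) (y : Site (3 + 1)) =>
                  (if s' ≤ k + 1 then
                    -(((Lc : ℝ) ^ ((3 + 1) * s'))⁻¹ * bmGaugeAt (toSite rr) (legAct (respStep (d := 3) (Lc ^ s') (Lc ^ (k + 2))) (delta1 μ z)) Lc y)
                   else 0)
                  + (if s' = 0 then (0 : ℝ)
                     else ((Lc : ℝ) ^ ((3 + 1) * (s' - 1)))⁻¹ * ((((box (3 + 1) Lc).card : ℝ))⁻¹ *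
                       zetaS (toSite r) Lc (legAct (legChain (respStepBmSeq (d := 3) (toSite rr) Lc) (s' - 1) (k + 1 - (s' - 1))) (delta1 μ z)) y)))
                  s' (blk (Lc ^ s') u')) ∧
        (∀ s', s' ≤ k + 2 → ∀ u' : Site (3 + 1),
          |(fun (s' : ℕ) (y : Site (3 + 1)) =>
              (if s' ≤ k + 1 then
                -(((Lc : ℝ) ^ ((3 + 1) * s'))⁻¹ * bmGaugeAt (toSite rr) (legAct (respStep (d := 3) (Lc ^ s') (Lc ^ (k + 2))) (delta1 μ z)) Lc y)
               else 0)
              + (if s' = 0 then (0 : ℝ)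
                 else ((Lc : ℝ) ^ ((3 + 1) * (s' - 1)))⁻¹ * ((((box (3 + 1) Lc).card : ℝ))⁻¹ *
                   zetaS (toSite r) Lc (legAct (legChain (respStepBmSeq (d := 3) (toSite rr) Lc) (s' - 1) (k + 1 - (s' - 1))) (delta1 μ z)) y)))
              s' (blk (Lc ^ s') u')|
            ≤ (α₀ * ((Lc : ℝ) ^ (5 * (k + 2)))⁻¹ * (Lc : ℝ) ^ s') * Real.exp (-(κ * supNorm (quo (Lc ^ (k + 2)) u' - z)))) ∧
        (∀ u' : Site (3 + 1),
          ((Lc : ℝ) ^ (3 + 1))⁻¹ *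
              (Psi (toSite rr) Lc 0 k (delta1 μ z) (blk Lc u') + PsiFace r (toSite rr) Lc 0 k (delta1 μ z) (blk Lc u')
                - bmGaugeAt (toSite rr) (respStep (d := 3) 1 (Lc ^ (k + 1)) μ z) Lc (blk Lc u'))
            = ∑ s' ∈ Finset.range (k + 2 + 1),
                (fun (s' : ℕ) (y : Site (3 + 1)) =>
                  (if s' = 0 then (0 : ℝ)
                   else if s' ≤ k + 1 then
                     -(((Lc : ℝ) ^ ((3 + 1) * s'))⁻¹ *
                       bmGaugeAt (toSite rr) (legAct (respStep (d := 3) (Lc ^ (s' - 1)) (Lc ^ (k + 1))) (delta1 μ z)) Lc y)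
                   else 0)
                  + (if s' ≤ 1 then (0 : ℝ)
                     else ((Lc : ℝ) ^ ((3 + 1) * (s' - 1)))⁻¹ * ((((box (3 + 1) Lc).card : ℝ))⁻¹ *
                       zetaS (toSite r) Lc (legAct (legChain (respStepBmSeq (d := 3) (toSite rr) Lc) (s' - 2) (k + 2 - s')) (delta1 μ z)) y)))
                  s' (blk (Lc ^ s') u')) ∧
        (∀ s', s' ≤ k + 2 → ∀ u' : Site (3 + 1),
          |(fun (s' : ℕ) (y : Site (3 + 1)) =>
              (if s' = 0 then (0 : ℝ)
               else if s' ≤ k + 1 then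
                 -(((Lc : ℝ) ^ ((3 + 1) * s'))⁻¹ *
                   bmGaugeAt (toSite rr) (legAct (respStep (d := 3) (Lc ^ (s' - 1)) (Lc ^ (k + 1))) (delta1 μ z)) Lc y)
               else 0)
              + (if s' ≤ 1 then (0 : ℝ)
                 else ((Lc : ℝ) ^ ((3 + 1) * (s' - 1)))⁻¹ * ((((box (3 + 1) Lc).card : ℝ))⁻¹ *
                   zetaS (toSite r) Lc (legAct (legChain (respStepBmSeq (d := 3) (toSite rr) Lc) (s' - 2) (k + 2 - s')) (delta1 μ z)) y)))
              s' (blk (Lc ^ s') u')|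
            ≤ (α₀ * ((Lc : ℝ) ^ (5 * (k + 2)))⁻¹ * (Lc : ℝ) ^ s') * Real.exp (-(κ * supNorm (quo (Lc ^ (k + 2)) u' - z)))) ∧
        (∀ u' : Site (3 + 1),
          (Psi (toSite rr) Lc 0 (k + 1) (delta1 μ z) u' + PsiFace r (toSite rr) Lc 0 (k + 1) (delta1 μ z) u'
              - bmGaugeAt (toSite rr) (respStep (d := 3) 1 (Lc ^ (k + 2)) μ z) Lc u')
            - ((Lc : ℝ) ^ (3 + 1))⁻¹ *
              (Psi (toSite rr) Lc 0 k (delta1 μ z) (blk Lc u') + PsiFace r (toSite rr) Lc 0 k (delta1 μ z) (blk Lc u')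
                - bmGaugeAt (toSite rr) (respStep (d := 3) 1 (Lc ^ (k + 1)) μ z) Lc (blk Lc u'))
            = ∑ s' ∈ Finset.range (k + 2 + 1),
                (fun (s' : ℕ) (y : Site (3 + 1)) =>
                  (if s' ≤ k + 1 then
                    (if s' = 0 then -bmGaugeAt (toSite rr) (legAct (respStep (d := 3) 1 (Lc ^ (k + 2))) (delta1 μ z)) Lc y
                     else -(((Lc : ℝ) ^ ((3 + 1) * s'))⁻¹ *
                       bmGaugeAt (toSite rr) (legAct (respStep (d := 3) (Lc ^ s') (Lc ^ (k + 2))) (delta1 μ z)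
                         - legAct (respStep (d := 3) (Lc ^ (s' - 1)) (Lc ^ (k + 1))) (delta1 μ z)) Lc y))
                   else 0)
                  + (if s' = 0 then (0 : ℝ)
                     else if s' = 1 then (((box (3 + 1) Lc).card : ℝ))⁻¹ * zetaS (toSite r) Lc (legAct (legChain (respStepBmSeq (d := 3) (toSite rr) Lc) 0 (k + 1)) (delta1 μ z)) y
                     else ((Lc : ℝ) ^ ((3 + 1) * (s' - 1)))⁻¹ * ((((box (3 + 1) Lc).card : ℝ))⁻¹ *
                       (zetaS (toSite r) Lc (legAct (legChain (respStepBmSeq (d := 3) (toSite rr) Lc) (s' - 1) (k + 2 - s')) (delta1 μ z)) y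
                        - zetaS (toSite r) Lc (legAct (legChain (respStepBmSeq (d := 3) (toSite rr) Lc) (s' - 2) (k + 2 - s')) (delta1 μ z)) y))))
                  s' (blk (Lc ^ s') u')) ∧
        (∀ s', s' ≤ k + 2 → ∀ u' : Site (3 + 1),
          |(fun (s' : ℕ) (y : Site (3 + 1)) =>
              (if s' ≤ k + 1 then
                (if s' = 0 then -bmGaugeAt (toSite rr) (legAct (respStep (d := 3) 1 (Lc ^ (k + 2))) (delta1 μ z)) Lc y
                 else -(((Lc : ℝ) ^ ((3 + 1) * s'))⁻¹ *
                   bmGaugeAt (toSite rr) (legAct (respStep (d := 3) (Lc ^ s') (Lc ^ (k + 2))) (delta1 μ z)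
                     - legAct (respStep (d := 3) (Lc ^ (s' - 1)) (Lc ^ (k + 1))) (delta1 μ z)) Lc y))
               else 0)
              + (if s' = 0 then (0 : ℝ)
                 else if s' = 1 then (((box (3 + 1) Lc).card : ℝ))⁻¹ * zetaS (toSite r) Lc (legAct (legChain (respStepBmSeq (d := 3) (toSite rr) Lc) 0 (k + 1)) (delta1 μ z)) y
                 else ((Lc : ℝ) ^ ((3 + 1) * (s' - 1)))⁻¹ * ((((box (3 + 1) Lc).card : ℝ))⁻¹ *
                   (zetaS (toSite r) Lc (legAct (legChain (respStepBmSeq (d := 3) (toSite rr) Lc) (s' - 1) (k + 2 - s')) (delta1 μ z)) y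
                    - zetaS (toSite r) Lc (legAct (legChain (respStepBmSeq (d := 3) (toSite rr) Lc) (s' - 2) (k + 2 - s')) (delta1 μ z)) y))))
              s' (blk (Lc ^ s') u')|
            ≤ ((if s' = 0 then α₀ else if s' = 1 then αd * θ ^ k * (Lc : ℝ) + α₀ else αd * θ ^ k * (Lc : ℝ) ^ s') * ((Lc : ℝ) ^ (5 * (k + 2)))⁻¹) *
              Real.exp (-(κ * supNorm (quo (Lc ^ (k + 2)) u' - z)))) := by
  obtain ⟨κ₀, C, -, hκ₀, hC, -, hN1', -⟩ := exists_respStep_decay_and_grad (Lc := Lc)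
  have hN1 : ∀ (m k : ℕ) (μ : Fin (3 + 1)) (z : Site (3 + 1)) (l'' : Fin (3 + 1)) (w' : Site (3 + 1)),
      |respStep (d := 3) (Lc ^ m) (Lc ^ (m + k + 1)) μ z l'' w'| ≤
        C * ((Lc : ℝ) ^ (5 * (k + 1)))⁻¹ * Real.exp (-(κ₀ * supNorm (quo (Lc ^ (k + 1)) w' - z))) := by
    intro m k μ z l'' w'
    have h := hN1' m k μ z l'' w'
    rwa [inv_cast_pow_pow] at h
  obtain ⟨c, θ, κ₁, hc, hθ0, hθ1, hκ₁, hCau⟩ := exists_respStep_cauchy (Lc := Lc) hLc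
  have hL0 : (0 : ℝ) ≤ Lc := by positivity
  set F : ℝ := ∑ r' ∈ box (3 + 1) Lc, faceWtSum r' Lc with hF
  have hF0 : 0 ≤ F := Finset.sum_nonneg fun r' _ => faceWtSum_nonneg r' Lc
  set α₀ : ℝ := 8 * (Lc : ℝ) * C + F * (1 + 8 * (Lc : ℝ) * (Real.exp κ₀ + 1)) * C with hα₀
  set αd : ℝ := (8 * (Lc : ℝ) + F * (1 + 8 * (Lc : ℝ) * (Real.exp κ₁ + 1))) * c with hαd
  have hα₀0 : 0 ≤ α₀ := by positivity
  have hαd0 : 0 ≤ αd := by positivity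
  have h8C : 8 * (Lc : ℝ) * C ≤ α₀ := by rw [hα₀]; nlinarith [mul_nonneg (mul_nonneg hF0 (by positivity : (0 : ℝ) ≤ 1 + 8 * (Lc : ℝ) * (Real.exp κ₀ + 1))) hC]
  have hFC : F * ((1 + 8 * (Lc : ℝ) * (Real.exp κ₀ + 1)) * C) ≤ α₀ := by
    rw [hα₀]; nlinarith [mul_nonneg (mul_nonneg hL0 hC) (by norm_num : (0 : ℝ) ≤ 8)]
  have h8c : 8 * (Lc : ℝ) * c ≤ αd := by rw [hαd]; nlinarith [mul_nonneg (mul_nonneg hF0 (by positivity : (0 : ℝ) ≤ 1 + 8 * (Lc : ℝ) * (Real.exp κ₁ + 1))) hc]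
  refine ⟨min κ₀ κ₁, α₀, αd, θ, lt_min hκ₀ hκ₁, hα₀0, hαd0, hθ0, hθ1, fun r hr rr hrr k μ z => ?_⟩
  have hFr : faceWtSum r Lc ≤ F := Finset.single_le_sum (fun r' _ => faceWtSum_nonneg r' Lc) hr
  have m0 : ∀ u' : Site (3 + 1), Real.exp (-(κ₀ * supNorm (quo (Lc ^ (k + 2)) u' - z))) ≤ Real.exp (-(min κ₀ κ₁ * supNorm (quo (Lc ^ (k + 2)) u' - z))) :=
    fun u' => exp_env_mono (min_le_left _ _) (supNorm_nonneg _)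
  have m1 : ∀ u' : Site (3 + 1), Real.exp (-(κ₁ * supNorm (quo (Lc ^ (k + 2)) u' - z))) ≤ Real.exp (-(min κ₀ κ₁ * supNorm (quo (Lc ^ (k + 2)) u' - z))) :=
    fun u' => exp_env_mono (min_le_right _ _) (supNorm_nonneg _)
  refine ⟨?_, ?_, ?_, ?_, ?_, ?_⟩
  · intro u'
    have h := combGauge_eq_staircase_zero (Lc := Lc) r (toSite rr) (k + 1) μ z u'
    rw [show k + 1 + 1 = k + 2 from rfl] at h
    exact h
  · intro s' hs u'
    have h := abs_combPieceZero_le hκ₀.le hC hN1 hr hrr hFr (k + 1) μ z (show s' ≤ k + 1 + 1 by omega) u'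
    rw [show k + 1 + 1 = k + 2 from rfl] at h
    exact h.trans (mul_le_mul_of_nonneg_left (m0 u') (by positivity))
  · intro u'
    exact combGauge_coarse_eq_staircase_fine (Lc := Lc) r (toSite rr) k μ z u'
  · intro s' hs u'
    exact (abs_combPieceUp_le hκ₀.le hC hN1 hr hrr hFr k μ z hs u').trans (mul_le_mul_of_nonneg_left (m0 u') (by positivity))
  · intro u'
    exact combGauge_refine_eq_staircase (Lc := Lc) r (toSite rr) k μ z u'
  · intro s' hs u'
    have hN5 : 0 ≤ ((Lc : ℝ) ^ (5 * (k + 2)))⁻¹ := by positivity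
    have hE : 0 ≤ Real.exp (-(min κ₀ κ₁ * supNorm (quo (Lc ^ (k + 2)) u' - z))) := (Real.exp_pos _).le
    rcases Nat.lt_or_ge s' 2 with hlt | hge
    · interval_cases s'
      · -- the (E) extra finest piece
        rw [if_pos rfl]
        refine (abs_combPieceDiff_zero_le hN1 hrr k μ z u').trans ?_
        calc 8 * (Lc : ℝ) * C * ((Lc : ℝ) ^ (5 * (k + 2)))⁻¹ * Real.exp (-(κ₀ * supNorm (quo (Lc ^ (k + 2)) u' - z)))
            ≤ α₀ * ((Lc : ℝ) ^ (5 * (k + 2)))⁻¹ * Real.exp (-(min κ₀ κ₁ * supNorm (quo (Lc ^ (k + 2)) u' - z))) :=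
              mul_le_mul (mul_le_mul_of_nonneg_right h8C hN5) (m0 u') (Real.exp_pos _).le (by positivity)
          _ = _ := by ring
      · -- scale 1: the differenced (E) piece + the extra finest face piece
        rw [if_neg one_ne_zero, if_pos rfl]
        refine (abs_combPieceDiff_one_le hκ₀.le hC hN1 hCau hr hrr hFr k μ z u').trans ?_
        have hθk : 0 ≤ θ ^ k := pow_nonneg hθ0 k
        have t1 : 8 * (Lc : ℝ) * (c * θ ^ k) * ((Lc : ℝ) ^ (5 * (k + 2)))⁻¹ * (Lc : ℝ) ^ 1 * Real.exp (-(κ₁ * supNorm (quo (Lc ^ (k + 2)) u' - z)))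
            ≤ αd * θ ^ k * (Lc : ℝ) * ((Lc : ℝ) ^ (5 * (k + 2)))⁻¹ * Real.exp (-(min κ₀ κ₁ * supNorm (quo (Lc ^ (k + 2)) u' - z))) := by
          have h1 : 8 * (Lc : ℝ) * (c * θ ^ k) * ((Lc : ℝ) ^ (5 * (k + 2)))⁻¹ * (Lc : ℝ) ^ 1 ≤ αd * θ ^ k * (Lc : ℝ) * ((Lc : ℝ) ^ (5 * (k + 2)))⁻¹ := by
            have := mul_le_mul_of_nonneg_right h8c (mul_nonneg (mul_nonneg hθk hL0) hN5)
            calc 8 * (Lc : ℝ) * (c * θ ^ k) * ((Lc : ℝ) ^ (5 * (k + 2)))⁻¹ * (Lc : ℝ) ^ 1 = (8 * (Lc : ℝ) * c) * (θ ^ k * (Lc : ℝ) * ((Lc : ℝ) ^ (5 * (k + 2)))⁻¹) := by ring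
              _ ≤ αd * (θ ^ k * (Lc : ℝ) * ((Lc : ℝ) ^ (5 * (k + 2)))⁻¹) := this
              _ = _ := by ring
          exact mul_le_mul h1 (m1 u') (Real.exp_pos _).le (by positivity)
        have t2 : F * ((1 + 8 * (Lc : ℝ) * (Real.exp κ₀ + 1)) * C * ((Lc : ℝ) ^ (5 * (k + 2)))⁻¹ * Real.exp (-(κ₀ * supNorm (quo (Lc ^ (k + 2)) u' - z))))
            ≤ α₀ * ((Lc : ℝ) ^ (5 * (k + 2)))⁻¹ * Real.exp (-(min κ₀ κ₁ * supNorm (quo (Lc ^ (k + 2)) u' - z))) := by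
          calc F * ((1 + 8 * (Lc : ℝ) * (Real.exp κ₀ + 1)) * C * ((Lc : ℝ) ^ (5 * (k + 2)))⁻¹ * Real.exp (-(κ₀ * supNorm (quo (Lc ^ (k + 2)) u' - z))))
              = (F * ((1 + 8 * (Lc : ℝ) * (Real.exp κ₀ + 1)) * C)) * ((Lc : ℝ) ^ (5 * (k + 2)))⁻¹ * Real.exp (-(κ₀ * supNorm (quo (Lc ^ (k + 2)) u' - z))) := by ring
            _ ≤ α₀ * ((Lc : ℝ) ^ (5 * (k + 2)))⁻¹ * Real.exp (-(min κ₀ κ₁ * supNorm (quo (Lc ^ (k + 2)) u' - z))) :=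
              mul_le_mul (mul_le_mul_of_nonneg_right hFC hN5) (m0 u') (Real.exp_pos _).le (by positivity)
        calc _ ≤ αd * θ ^ k * (Lc : ℝ) * ((Lc : ℝ) ^ (5 * (k + 2)))⁻¹ * Real.exp (-(min κ₀ κ₁ * supNorm (quo (Lc ^ (k + 2)) u' - z)))
              + α₀ * ((Lc : ℝ) ^ (5 * (k + 2)))⁻¹ * Real.exp (-(min κ₀ κ₁ * supNorm (quo (Lc ^ (k + 2)) u' - z))) := add_le_add t1 t2
          _ = _ := by ring
    · rw [if_neg (show s' ≠ 0 by omega), if_neg (show s' ≠ 1 by omega)]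
      refine (abs_combPieceDiff_le hκ₁.le hc hθ0 hCau hr hrr hFr k μ z hge hs u').trans ?_
      calc (8 * (Lc : ℝ) + F * (1 + 8 * (Lc : ℝ) * (Real.exp κ₁ + 1))) * (c * θ ^ k) * ((Lc : ℝ) ^ (5 * (k + 2)))⁻¹ * (Lc : ℝ) ^ s' *
            Real.exp (-(κ₁ * supNorm (quo (Lc ^ (k + 2)) u' - z)))
          ≤ (8 * (Lc : ℝ) + F * (1 + 8 * (Lc : ℝ) * (Real.exp κ₁ + 1))) * (c * θ ^ k) * ((Lc : ℝ) ^ (5 * (k + 2)))⁻¹ * (Lc : ℝ) ^ s' *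
            Real.exp (-(min κ₀ κ₁ * supNorm (quo (Lc ^ (k + 2)) u' - z))) := mul_le_mul_of_nonneg_left (m1 u') (by positivity)
        _ = _ := by rw [hαd]; ring

end Summit.QuantumFields.BalabanUV.Beta.GAN24.CombContactGaugeStaircaseCauchyHolds

end
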